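import Mathlib
import HarnessLib
import Literature.AlgebraicGeometry.Resolution.QuadraticTransforms
import Summits.ResolutionOfSingularities.ResolutionOfSingularities.Theorems.WildQuotientsWildQuotientResolutionPGroupEigenline
import Summits.ResolutionOfSingularities.ResolutionOfSingularities.Theorems.WildQuotientsWildQuotientResolutionEigenlineQuadraticTransform
import Summits.ResolutionOfSingularities.ResolutionOfSingularities.Theorems.WildQuotientsWildQuotientResolutionKSBlowupEquivariantChart

/-!
# Kollár–Szabó going down, blow-up step (K2-glue, general group): the equivariant quadratic transform from a
# STABLE TANGENT HYPERPLANE, and the WILD (p-group) case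
# (crux `WildQuotients.WildQuotientResolution`, stub `stub_phaseZeroHighDim`)

Crux stmt-ResolutionOfSingularities-15640 (`WildQuotientResolution`), registered stub `stub_phaseZeroHighDim`;
programme PHASE0-KS-EIGENLINE. ✓`KSGoingDown.exists_equivariant_quadraticTransform_of_action` (p828706) needs the
acting group to be ABELIAN only to find the stable tangent hyperplane. This file factors that out:

* `exists_equivariant_quadraticTransform_of_stableHyperplane` — for ANY group `I` acting residue-trivially by ring
  automorphisms on a regular local domain `A` (not a field) and any `I`-stable ideal `𝔪² ≤ W < 𝔪` of codimension one:
  the local subring `R ⊆ Frac A` (a quadratic transform of the image of `A`), the injective local `ι : A → R`,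
  `t ≠ 0` with `𝔪_A R = (t)`, residue-trivial endomorphisms `α_g ∘ ι = ι ∘ τ_g`, and the same residue field — the
  proof of p828706 with the hyperplane transported along `A ≅ S ⊆ Frac A` instead of produced from commutativity;
* `exists_equivariant_quadraticTransform_of_isPGroup` — **the WILD case**: `I` a finite `p`-group and
  `char κ(A) = p` (no algebraic closure), via ✓`PGroupEigenline.exists_stable_tangentHyperplane_of_isPGroup`.

With it, the scheme-level chain (✓`KSBlowupLocalChart`, ✓`KSBlowupFixedPointStalk`, ✓`…Regular`, ✓`…Dim`) runs for
wild inertia verbatim: point blow-ups at fixed points never shrink a wild (p-group) inertia group.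

[OURS · crux stmt-ResolutionOfSingularities-15640 · helper toward `stub_phaseZeroHighDim` (algebraic glue, general
group / wild case; NOT a proof of the stub); folklore, counted 0; AI-level work, weaker than expert review.] [folklore]
-/

-- single-problem summit: the doubled namespace component `ResolutionOfSingularities` is forced
set_option linter.dupNamespace false

noncomputable section

open IsLocalRing
open Literature.AlgebraicGeometry.Resolution
open Summit.ResolutionOfSingularities.ResolutionOfSingularities.Theorems.WildQuotientResolution

namespace Summit.ResolutionOfSingularities.ResolutionOfSingularities.Theorems.WildQuotientResolution.KSGoingDown

universe u

/-! ## Transport of a stable tangent hyperplane along a ring isomorphism -/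

section Transport

variable {A B : Type u} [CommRing A] [CommRing B] [IsLocalRing A] [IsLocalRing B] (e : A ≃+* B)

/-- Transport of the stable-tangent-hyperplane package `(𝔪² ≤ W ≤ 𝔪, W ≠ 𝔪, W + (t) = 𝔪, τ-stable)` along a ring
isomorphism `e : A ≃ B`, for the transported action `τ' g = e ∘ τ g ∘ e⁻¹`. [folklore] -/
theorem transport_stableHyperplane {I : Type*} [Group I] (τ : I →* (A ≃+* A)) (τ' : I →* (B ≃+* B))
    (hτ' : ∀ (g : I) (b : B), τ' g b = e (τ g (e.symm b)))
    (W : Ideal A) (hW2 : maximalIdeal A ^ 2 ≤ W) (hWle : W ≤ maximalIdeal A) (hWne : W ≠ maximalIdeal A)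
    (hsup : ∀ t ∈ maximalIdeal A, t ∉ W → W ⊔ Ideal.span {t} = maximalIdeal A)
    (hstab : ∀ g : I, ∀ w ∈ W, τ g w ∈ W) :
    maximalIdeal B ^ 2 ≤ W.map e ∧ W.map e ≤ maximalIdeal B ∧ W.map e ≠ maximalIdeal B ∧
      (∀ t ∈ maximalIdeal B, t ∉ W.map e → W.map e ⊔ Ideal.span {t} = maximalIdeal B) ∧
      ∀ g : I, ∀ w ∈ W.map e, τ' g w ∈ W.map e := by
  have hmem : ∀ b : B, b ∈ W.map e ↔ e.symm b ∈ W := fun b => by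
    rw [show W.map e = W.map (e : A →+* B) from rfl, Ideal.map_comap_of_equiv, Ideal.mem_comap]
  have hmax : (maximalIdeal A).map e = maximalIdeal B := map_ringEquiv_maximalIdeal e
  refine ⟨?_, ?_, ?_, ?_, ?_⟩
  · rw [← hmax, ← Ideal.map_pow]
    exact Ideal.map_mono hW2
  · rw [← hmax]
    exact Ideal.map_mono hWle
  · intro h
    apply hWne
    apply le_antisymm hWle
    intro a ha
    have : e a ∈ W.map e := by rw [h]; exact map_mem_maximalIdeal_of_ringEquiv e ha
    rw [hmem, e.symm_apply_apply] at this
    exact this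
  · intro t ht htW
    have ht' : e.symm t ∈ maximalIdeal A := map_mem_maximalIdeal_of_ringEquiv e.symm ht
    have htW' : e.symm t ∉ W := fun h => htW ((hmem t).mpr h)
    have h := congrArg (Ideal.map e) (hsup _ ht' htW')
    rw [Ideal.map_sup, Ideal.map_span, Set.image_singleton, e.apply_symm_apply, hmax] at h
    exact h
  · intro g w hw
    rw [hmem] at hw ⊢
    rw [hτ', e.symm_apply_apply]
    exact hstab g _ hw

end Transport

/-- **The eigenvalue along a transversal parameter is a unit** — ✓`AbelianEigenline.exists_unit_mul_sub_mem_of_not_mem`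
for an ARBITRARY group (its proof never used commutativity): for `𝔪² ≤ W`, `W + (t) = 𝔪` (`t ∉ W`), `W` stable under a
residue-trivial action, `τ g t ≡ u t (mod W)` with `u` a unit. [folklore] -/
theorem exists_unit_mul_sub_mem_of_not_mem_of_group {A : Type u} [CommRing A] [IsLocalRing A]
    {I : Type*} [Group I] (τ : I →* (A ≃+* A)) (hres : ∀ (g : I) (a : A), τ g a - a ∈ maximalIdeal A)
    (W : Ideal A) (hW2 : maximalIdeal A ^ 2 ≤ W) (hstab : ∀ g : I, ∀ w ∈ W, τ g w ∈ W)
    {t : A} (ht : t ∈ maximalIdeal A) (htW : t ∉ W) (hsup : W ⊔ Ideal.span {t} = maximalIdeal A) (g : I) :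
    ∃ u : A, IsUnit u ∧ τ g t - u * t ∈ W := by
  -- adapted from `AbelianEigenline.exists_unit_mul_sub_mem_of_not_mem` (commutativity unused there)
  have hgt : τ g t ∈ maximalIdeal A := CotangentRep.maximalIdeal_le_comap (τ g) (hres g) ht
  rw [← hsup] at hgt
  obtain ⟨w, hw, c, hc, hwc⟩ := Submodule.mem_sup.mp hgt
  obtain ⟨u, rfl⟩ := Ideal.mem_span_singleton'.mp hc
  refine ⟨u, ?_, by rw [← hwc]; simpa using hw⟩
  by_contra hu
  have hum : u ∈ maximalIdeal A := (IsLocalRing.mem_maximalIdeal u).mpr (mem_nonunits_iff.mpr hu)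
  have hut : u * t ∈ W := hW2 (by rw [pow_two]; exact Ideal.mul_mem_mul hum ht)
  have hgtW : τ g t ∈ W := by rw [← hwc]; exact add_mem hw hut
  have : t ∈ W := by
    have h := hstab g⁻¹ _ hgtW
    rwa [← RingAut.mul_apply, ← map_mul, inv_mul_cancel, map_one, RingAut.one_apply] at h
  exact htW this

/-! ## The equivariant quadratic transform from a stable tangent hyperplane (any group) -/

/-- **The equivariant quadratic transform from a stable tangent hyperplane.** Let `A` be a regular local domain,
`I` ANY group acting on `A` by ring automorphisms `τ_g` with `τ_g a − a ∈ 𝔪_A`, and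
`𝔪² ≤ W ≤ 𝔪`, `W ≠ 𝔪`, `W + (t) = 𝔪` (`t ∉ W`) an `I`-stable ideal. Then there are a local subring `R ⊆ Frac A`,
a quadratic transform of the image of `A`, an injective local ring map `ι : A → R`, `t ∈ R`, `t ≠ 0`, with
`𝔪_A · R = (t)`, ring endomorphisms `α_g` of `R` with `α_g ∘ ι = ι ∘ τ_g`, `α_g r − r ∈ 𝔪_R`, and every `r ∈ R`
congruent modulo `𝔪_R` to some `ι a` (the proof of ✓`exists_equivariant_quadraticTransform_of_action`, with the
hyperplane transported instead of produced). [cite: ReichsteinYoussin2000, Appendix, proof of Prop. A.2] -/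
theorem exists_equivariant_quadraticTransform_of_stableHyperplane {A : Type u} [CommRing A] [IsDomain A]
    [IsRegularLocalRing A]
    {I : Type*} [Group I] (τ : I →* (A ≃+* A)) (hres : ∀ (g : I) (a : A), τ g a - a ∈ maximalIdeal A)
    (W : Ideal A) (hW2 : maximalIdeal A ^ 2 ≤ W) (hWle : W ≤ maximalIdeal A) (hWne : W ≠ maximalIdeal A)
    (hsup : ∀ t ∈ maximalIdeal A, t ∉ W → W ⊔ Ideal.span {t} = maximalIdeal A)
    (hstab : ∀ g : I, ∀ w ∈ W, τ g w ∈ W) :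
    ∃ (R : Subring (FractionRing A)) (_ : IsLocalRing R) (ι : A →+* R) (_ : IsLocalHom ι) (t : R)
      (α : I → (R →+* R)),
      IsQuadraticTransform (algebraMap A (FractionRing A)).range R ∧
      (∀ a : A, ((ι a : R) : FractionRing A) = algebraMap A (FractionRing A) a) ∧
      Function.Injective ι ∧ t ≠ 0 ∧ (maximalIdeal A).map ι = Ideal.span {t} ∧
      (∀ g : I, (α g).comp ι = ι.comp (τ g : A →+* A)) ∧
      (∀ (g : I) (r : R), α g r - r ∈ maximalIdeal R) ∧
      (∀ r : R, ∃ a : A, ι a - r ∈ maximalIdeal R) := by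
  classical
  -- the model `S = image of A` in `K = Frac A`
  let K := FractionRing A
  let f : A →+* K := algebraMap A K
  have hf : Function.Injective f := IsFractionRing.injective A K
  let S : Subring K := f.range
  have hrr : Function.Injective f.rangeRestrict := fun a b h => hf (congrArg Subtype.val h)
  let e : A ≃+* S := RingEquiv.ofBijective f.rangeRestrict ⟨hrr, RingHom.rangeRestrict_surjective f⟩
  have he : ∀ a : A, ((e a : S) : K) = f a := fun a => rfl
  haveI : IsRegularLocalRing S := IsRegularLocalRing.of_ringEquiv e
  -- the transported action on `S` and the extended action on `K`
  obtain ⟨τS, hτS⟩ := exists_transport_action e τ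
  have hresS : ∀ (g : I) (s : S), τS g s - s ∈ maximalIdeal S := transport_residueTrivial e τ hres τS hτS
  let σK : I → (K ≃+* K) := fun g => IsFractionRing.ringEquivOfRingEquiv (τ g)
  have hσK : ∀ (g : I) (a : A), σK g (f a) = f (τ g a) := fun g a =>
    IsFractionRing.ringEquivOfRingEquiv_algebraMap (τ g) a
  have hσS : ∀ g : I, ∀ s ∈ S, σK g s ∈ S := by
    rintro g _ ⟨a, rfl⟩
    exact ⟨τ g a, (hσK g a).symm⟩
  have heS : ∀ (s : S), ∃ a : A, s = e a := fun s => ⟨e.symm s, (e.apply_symm_apply s).symm⟩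
  have hσS' : ∀ (g : I) (s : S), (⟨σK g s, hσS g s s.2⟩ : S) = τS g s := by
    intro g s
    obtain ⟨a, rfl⟩ := heS s
    apply Subtype.ext
    change σK g (f a) = ((τS g (e a) : S) : K)
    rw [hσK, hτS, e.symm_apply_apply, he]
  -- the transported hyperplane `W.map e` and an adapted regular system of parameters `x`, `x i = t`
  obtain ⟨hW2', hWle', hWne', hsup', hstab'⟩ :=
    transport_stableHyperplane e τ τS hτS W hW2 hWle hWne hsup hstab
  obtain ⟨t, htm, htW⟩ : ∃ t ∈ maximalIdeal S, t ∉ W.map e :=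
    SetLike.exists_of_lt (lt_of_le_of_ne hWle' hWne')
  obtain ⟨x, i, hx, hxit, hxW, hWle''⟩ :=
    EigenlineChart.exists_rsop_adapted_to_hyperplane (A := S) rfl (W.map e) hW2' htm htW (hsup' t htm htW)
  have hxi : x i ≠ 0 := by
    rw [hxit]
    rintro rfl
    exact htW (W.map e).zero_mem
  have hres' : ∀ (g : I) (s : S), (⟨σK g s, hσS g s s.2⟩ : S) - s ∈ maximalIdeal S := fun g s => by
    rw [hσS']
    exact hresS g s
  have hWσ : ∀ (g : I) (j), j ≠ i → (⟨σK g ((x j : S) : K), hσS g _ (x j).2⟩ : S) ∈ W.map e :=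
    fun g j hj => by
    rw [hσS']
    exact hstab' g _ (hxW j hj)
  have ht' : ∀ g : I, ∃ u : S, IsUnit u ∧
      (⟨σK g ((x i : S) : K), hσS g _ (x i).2⟩ : S) - u * x i ∈ W.map e := fun g => by
    rw [hσS', hxit]
    exact exists_unit_mul_sub_mem_of_not_mem_of_group τS hresS (W.map e) hW2' hstab' htm htW
      (hsup' t htm htW) g
  -- hand 8-g1: the stable quadratic transform
  obtain ⟨R₁, hQT, -, hfrac, hstabR, hresR, hcongR⟩ :=
    EigenlineChart.exists_equivariant_quadraticTransform S rfl x hx i hxi hWle'' σK hσS hres' hWσ ht'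
  haveI : IsLocalRing R₁ := hQT.isLocalRing
  have hSR : S ≤ R₁ := hQT.dominates.1
  -- the structure map `ι : A → R₁`
  let ι : A →+* R₁ := (Subring.inclusion hSR).comp (e : A →+* S)
  have hι : ∀ a : A, ((ι a : R₁) : K) = f a := fun a => rfl
  have hιinj : Function.Injective ι := fun a b h => hf (by rw [← hι, ← hι, h])
  haveI hloc : IsLocalHom ι := by
    refine ⟨fun a ha => ?_⟩
    obtain ⟨h0, hinv⟩ := (isUnit_subring_iff_inv_mem (ι a)).mp ha
    rw [hι] at h0 hinv
    have hinvS : (f a)⁻¹ ∈ S := hQT.dominates.2 (f a) ⟨a, rfl⟩ hinv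
    have hu : IsUnit (e a) := (isUnit_subring_iff_inv_mem (e a)).mpr ⟨h0, hinvS⟩
    simpa using hu.map e.symm
  -- the element `t = x i` read in `R₁` and `𝔪_A R₁ = (t)`
  let tR : R₁ := ⟨((x i : S) : K), hSR (x i).2⟩
  have htR0 : tR ≠ 0 := by
    intro h
    have h' : ((x i : S) : K) = 0 := congrArg Subtype.val h
    exact hxi (Subtype.ext h')
  have hmapS : (maximalIdeal A).map (e : A →+* S) = maximalIdeal S := map_ringEquiv_maximalIdeal e
  have hmap : (maximalIdeal A).map ι = Ideal.span {tR} := by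
    change (maximalIdeal A).map ((Subring.inclusion hSR).comp (e : A →+* S)) = _
    rw [← Ideal.map_map, hmapS, ← hx, Ideal.map_span]
    apply le_antisymm
    · refine Ideal.span_le.mpr ?_
      rintro _ ⟨_, ⟨j, rfl⟩, rfl⟩
      by_cases hj : j = i
      · subst hj
        exact Ideal.subset_span rfl
      · obtain ⟨hq, -⟩ := hfrac j hj
        refine Ideal.mem_span_singleton'.mpr ⟨⟨_, hq⟩, Subtype.ext ?_⟩
        change ((x j : S) : K) / ((x i : S) : K) * ((x i : S) : K) = ((x j : S) : K)
        exact div_mul_cancel₀ _ fun h => hxi (Subtype.ext h)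
    · refine Ideal.span_le.mpr ?_
      rintro _ rfl
      exact Ideal.subset_span ⟨x i, ⟨i, rfl⟩, rfl⟩
  -- the restricted endomorphisms
  let α : I → (R₁ →+* R₁) := fun g => (σK g : K →+* K).restrict R₁ R₁ (hstabR g)
  have hα : ∀ (g : I) (r : R₁), ((α g r : R₁) : K) = σK g r := fun g r => rfl
  refine ⟨R₁, inferInstance, ι, hloc, tR, α, hQT, hι, hιinj, htR0, hmap, fun g => ?_, fun g r => ?_,
    fun r => ?_⟩
  · ext a
    change σK g (f a) = f (τ g a)
    exact hσK g a
  · rw [mem_maximalIdeal_iff_inv_not_mem]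
    have e1 : ((α g r - r : R₁) : K) = σK g r - r := by rw [AddSubgroupClass.coe_sub, hα]
    rw [e1]
    exact hresR g r r.2
  · obtain ⟨s, hs, hrs⟩ := hcongR r r.2
    obtain ⟨a, ha⟩ := heS ⟨s, hs⟩
    have ha : ((e a : S) : K) = s := (congrArg Subtype.val ha).symm
    refine ⟨a, ?_⟩
    have e2 : ι a - r = -(r - ι a) := by ring
    rw [e2]
    refine neg_mem_iff.mpr ?_
    rw [mem_maximalIdeal_iff_inv_not_mem]
    have e3 : ((r - ι a : R₁) : K) = (r : K) - s := by
      rw [AddSubgroupClass.coe_sub, hι, ← he, ← ha]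
    rw [e3]
    exact hrs

/-- **The WILD case: the equivariant quadratic transform for a `p`-group.** For a regular local domain `A`, not a
field, whose residue field has characteristic `p`, and a residue-trivial action of a finite `p`-GROUP `I` by ring
automorphisms: the conclusion of ✓`exists_equivariant_quadraticTransform_of_action` holds (no commutativity, no
algebraic closure), via the wild eigenline ✓`PGroupEigenline.exists_stable_tangentHyperplane_of_isPGroup`.
[cite: ReichsteinYoussin2000, Appendix, Lemma A.1 and proof of Prop. A.2] -/
theorem exists_equivariant_quadraticTransform_of_isPGroup {A : Type u} [CommRing A] [IsDomain A]
    [IsRegularLocalRing A] (hA : ¬ IsField A) {p : ℕ} [Fact p.Prime] [CharP (ResidueField A) p]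
    {I : Type*} [Group I] [Finite I] (hI : IsPGroup p I) (τ : I →* (A ≃+* A))
    (hres : ∀ (g : I) (a : A), τ g a - a ∈ maximalIdeal A) :
    ∃ (R : Subring (FractionRing A)) (_ : IsLocalRing R) (ι : A →+* R) (_ : IsLocalHom ι) (t : R)
      (α : I → (R →+* R)),
      IsQuadraticTransform (algebraMap A (FractionRing A)).range R ∧
      (∀ a : A, ((ι a : R) : FractionRing A) = algebraMap A (FractionRing A) a) ∧
      Function.Injective ι ∧ t ≠ 0 ∧ (maximalIdeal A).map ι = Ideal.span {t} ∧
      (∀ g : I, (α g).comp ι = ι.comp (τ g : A →+* A)) ∧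
      (∀ (g : I) (r : R), α g r - r ∈ maximalIdeal R) ∧
      (∀ r : R, ∃ a : A, ι a - r ∈ maximalIdeal R) := by
  obtain ⟨W, hW2, hWle, hWne, hsup, hstab⟩ :=
    PGroupEigenline.exists_stable_tangentHyperplane_of_isPGroup τ hres hI hA
  exact exists_equivariant_quadraticTransform_of_stableHyperplane τ hres W hW2 hWle hWne hsup hstab

end Summit.ResolutionOfSingularities.ResolutionOfSingularities.Theorems.WildQuotientResolution.KSGoingDown

end
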